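import Literature.NumberTheory.Automorphic.ArchInnerFormCartanAtlasCentralizer     -- ★ `gprimeTorus_mem_centralizer`; brings ★ `ArchInnerFormCartanAtlas` (`gprimeTorus`)
import Literature.NumberTheory.Automorphic.ArchInnerFormChartMeasures              -- ★ (T-MEAS-G′) `chartTorusG`, `chartHaarG`, `chartQuotientMeasureG`, `chartOrbG`, `chartOrbG_def`
import Literature.MeasureTheory.Group.OrbitalDescentChartTorus                     -- ★ p850136 (J-DESC) D3: `integral_descConj_eq_integral_descConj_descended`
import Literature.MeasureTheory.Group.OrbitalDescentContinuous                     -- ★ p850135 (J-DESC) D2: `continuous_integral_conj_subtype` (+ ★ cut-off, ★ `hasCompactSupport_integral_conj`)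
import HarnessLib

/-!
# Descent of the chart orbital functional `chartOrbG` to the centraliser of a chart point: ONE descended test function for a whole family of chart points
# (Rogawski 1990 §4.12 Lemma 4.12.1, §8.2 p. 114; Harish-Chandra–van Dijk 1970 Part I §3 Lemmas 22–23; Folland 1995 Thm. 2.49)

Topic `NumberTheory/Rogawski1990`; namespace `Literature.NumberTheory.Rogawski1990`.  THEOREMS ONLY (no `def`, no instance, no notation, no axiom, no named fact, no `sorry`).
Cell `pub/hodgecm-mathlib`, crux H413 (`stmt-HodgeConjecture-24833`), F0∕P3c line LH3 (closer stub `stub_N9`, organ J), brick **(J-DESC) FILE D4b-2** (seat F0P3a-p08 (g22)):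
the DOCK of the descent chain ★ D1–D4 to the LH3 atlas currency ★ `chartOrbG L α ν′ S′ a′ c = dt′(B′) · ∫_{G′_∞ ⧸ T_{S′}} a′(y · gprimeTorus α S′ c · y⁻¹) d(ν′ ∕ dt′)` (LH3-p02 (g2),
★ `ArchInnerFormChartMeasures`).  CHART-GENERIC: the semi-regular geometry enters only through the hypothesis `hCM` (ONE compact `C″` for all `c ∈ K`), which ★ D4b-1
`exists_isCompact_mul_gprimeTorus_of_semireg` (compact-wall side) and ★∕filed D4b-1β `exists_isCompact_mul_gprimeTorus_of_semireg_split` (split side, Cayley point) supply.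

THE STATEMENT (`exists_descended_chartOrbG_eq`).  `M′ := Z(gprimeTorus α S′ p)` (any coordinate `p`; closed), `T′ := T_{S′} ∩ M′` (`T_{S′} = chartTorusG ≤ M′`, ★
`chartTorusG_le_centralizer`), `νT′ := dt′` transported to `T′`, `νM` ANY right- and inversion-invariant Haar measure on `M′` (the (M-UNFOLD) brick identifies `M′ ≅ U(1,1) × U(1) × tori`
and supplies one), `a′ ∈ C_c(G′_∞)`, and ONE compact `C″ ⊆ G′_∞` with `y′·gprimeTorus c·y′⁻¹ ∈ tsupport a′ ⇒ y′ ∈ C″·M′` for all `c ∈ K`.  THEN (the instance binder `[LocallyCompactSpace ↥M′]` is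
`(isClosed_centralizer_singleton_of_t2 _).locallyCompactSpace` at the call site) there is ONE `(a′)_M ∈ C_c(M′)`
(continuous, compactly supported — `(a′)_M(m) = ∫ β(x) • a′(x m x⁻¹) dν′` for one cut-off `β`) such that for every `c ∈ K` at which the chart integrand is integrable (★ D3 §1:
every regular `c`),
  **`chartOrbG L α ν′ S′ a′ c = dt′(B′) · ∫_{M′ ⧸ T′} (a′)_M(k · gprimeTorus α S′ c · k⁻¹) d(νM ∕ νT′)(k̇)`**
— so on `K` the chart orbital functional of `G′_∞` IS an `M′`-orbital functional of ONE test function on `M′` (jumps∕limits across a wall inside `gprimeTorus(K)` are `M′`-side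
statements: (J-G′-JUMP) LH7-p01, (G′-CAY) LH3-p02, both after (M-UNFOLD)).
* §1 plumbing: `isClosed_centralizer_gprimeTorus`, `isClosed_subgroupOf_chartTorusG`, `isMulRightInvariant_chartHaarG`, `isHaarMeasure_map_subgroupOfEquivOfLe_symm`,
  `isInvInvariant_map_subgroupOfEquivOfLe_symm`, `chartHaarG_eq_map_incl`;
* §2 **`exists_descended_chartOrbG_eq`**.
HONEST LABEL: HC_CM is proved only modulo the 7 printed citations (2 remaining named inputs: hLiu418 = `stmt-HodgeConjecture-24832`, h413 = `stmt-HodgeConjecture-24833`) until rung 0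
closes; count-neutral measure-theoretic bookkeeping under organ J of `stub_N9`.

## References
* [Rogawski1990] J. D. Rogawski, *Automorphic Representations of Unitary Groups in Three Variables*, Ann. of Math. Stud. 123 (1990), §4.12 Lemma 4.12.1 p. 66 (`Φ_ε(xδ₀, ϕ) = Φ_M(x, φ)`
  for ALL `x` near `1` with ONE `φ`), §8.2 p. 114, §8.2 p. 122 (orbital integrals on `T_reg`).
* [HarishChandra1970] Harish-Chandra (notes by G. van Dijk), *Harmonic Analysis on Reductive p-adic Groups*, LNM 162 (1970), Part I §3 Lemmas 22–23.
* [Folland1995] G. B. Folland, *A Course in Abstract Harmonic Analysis* (1995), §2.6 Thm. 2.49.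
* [DeitmarEchterhoff2014] A. Deitmar, S. Echterhoff, *Principles of Harmonic Analysis*, 2nd ed. (2014), Thm. 1.5.3, Lemma 9.3.3.
-/

set_option autoImplicit false

noncomputable section

open MeasureTheory MeasureTheory.Measure Set Topology NumberField NumberField.InfinitePlace
open Literature.MeasureTheory.Group Literature.NumberTheory.Automorphic Literature.NumberTheory.Automorphic.UnitaryGroup
open scoped MatrixGroups Matrix Pointwise

namespace Literature.NumberTheory.Rogawski1990

/-! ## §1 Plumbing: closedness, the transported torus measure, right invariance -/

section Plumbing

variable {G : Type*} [Group G] [TopologicalSpace G] [IsTopologicalGroup G]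

/-- The centraliser of a point of a Hausdorff topological group is closed. [cite: DeitmarEchterhoff2014, Lemma 9.3.3] -/
theorem isClosed_centralizer_singleton_of_t2 [T2Space G] (s : G) : IsClosed ((Subgroup.centralizer ({s} : Set G) : Subgroup G) : Set G) := by
  have h : ((Subgroup.centralizer ({s} : Set G) : Subgroup G) : Set G) = {g : G | g * s = s * g} := by
    ext g; exact Subgroup.mem_centralizer_singleton_iff
  rw [h]
  exact isClosed_eq (continuous_id.mul continuous_const) (continuous_const.mul continuous_id)

omit [IsTopologicalGroup G] in
/-- `H ∩ K` is closed in `K` when `H` is closed in `G`. [cite: Folland1995, §2.6 Thm. 2.49] -/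
theorem isClosed_subgroupOf_of_isClosed (H K : Subgroup G) (hH : IsClosed (H : Set G)) : IsClosed ((H.subgroupOf K : Subgroup K) : Set K) := by
  have h : ((H.subgroupOf K : Subgroup K) : Set K) = ((↑) : K → G) ⁻¹' (H : Set G) := by
    ext k; rfl
  rw [h]
  exact hH.preimage continuous_subtype_val

omit [IsTopologicalGroup G] in
/-- The inclusion `H.subgroupOf K → H` (for `H ≤ K`) and its inverse are continuous. [cite: Folland1995, §2.6 Thm. 2.49] -/
theorem continuous_subgroupOfEquivOfLe {H K : Subgroup G} (h : H ≤ K) :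
    Continuous (Subgroup.subgroupOfEquivOfLe h) ∧ Continuous (Subgroup.subgroupOfEquivOfLe h).symm :=
  ⟨(continuous_subtype_val.comp continuous_subtype_val).subtype_mk _,
    (continuous_subtype_val.subtype_mk _).subtype_mk _⟩

variable [MeasurableSpace G] [BorelSpace G]

/-- A left-invariant, inversion-invariant measure is right-invariant (`μ = μ.inv`). [cite: Folland1995, §2.6 Thm. 2.49] -/
theorem isMulRightInvariant_of_isInvInvariant {T : Type*} [Group T] [TopologicalSpace T] [IsTopologicalGroup T] [MeasurableSpace T] [BorelSpace T]
    (μ : Measure T) [μ.IsMulLeftInvariant] [μ.IsInvInvariant] : μ.IsMulRightInvariant := by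
  have h : (μ.inv).IsMulRightInvariant := inferInstance
  rwa [Measure.inv_eq_self] at h

/-- The transport of a Haar measure on `H` to `H.subgroupOf K` (`H ≤ K`) along the canonical isomorphism is a Haar measure. [cite: Folland1995, §2.6 Thm. 2.49] -/
theorem isHaarMeasure_map_subgroupOfEquivOfLe_symm [LocallyCompactSpace G] {H K : Subgroup G} (h : H ≤ K) (μ : Measure H) [μ.IsHaarMeasure] :
    (Measure.map (Subgroup.subgroupOfEquivOfLe h).symm μ).IsHaarMeasure :=
  (Subgroup.subgroupOfEquivOfLe h).symm.isHaarMeasure_map μ (continuous_subgroupOfEquivOfLe h).2 (continuous_subgroupOfEquivOfLe h).1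

/-- The transport of an inversion-invariant measure along a group isomorphism is inversion invariant. [cite: Folland1995, §2.6 Thm. 2.49] -/
theorem isInvInvariant_map_subgroupOfEquivOfLe_symm {H K : Subgroup G} (h : H ≤ K) (μ : Measure H) [μ.IsInvInvariant] :
    (Measure.map (Subgroup.subgroupOfEquivOfLe h).symm μ).IsInvInvariant := by
  have hc := (continuous_subgroupOfEquivOfLe h).2.measurable
  refine ⟨?_⟩
  rw [Measure.inv, Measure.map_map measurable_inv hc]
  have hcomp : (Inv.inv ∘ ⇑(Subgroup.subgroupOfEquivOfLe h).symm) = ⇑(Subgroup.subgroupOfEquivOfLe h).symm ∘ Inv.inv := by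
    funext x; simp
  rw [hcomp, ← Measure.map_map hc measurable_inv]
  congr 1
  exact Measure.inv_eq_self μ

omit [IsTopologicalGroup G] in
/-- `μ = incl_* ((e⁻¹)_* μ)` for the inclusion `incl : H.subgroupOf K → H` (= `e := subgroupOfEquivOfLe h` pointwise). [cite: Folland1995, §2.6 Thm. 2.49] -/
theorem eq_map_incl_map_subgroupOfEquivOfLe_symm {H K : Subgroup G} (h : H ≤ K) (μ : Measure H) :
    μ = Measure.map (fun s : H.subgroupOf K => (⟨((s : K) : G), Subgroup.mem_subgroupOf.1 s.2⟩ : H)) (Measure.map (Subgroup.subgroupOfEquivOfLe h).symm μ) := by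
  have he : (fun s : H.subgroupOf K => (⟨((s : K) : G), Subgroup.mem_subgroupOf.1 s.2⟩ : H)) = ⇑(Subgroup.subgroupOfEquivOfLe h) := by
    funext s; rfl
  rw [he, Measure.map_map (continuous_subgroupOfEquivOfLe h).1.measurable (continuous_subgroupOfEquivOfLe h).2.measurable]
  have hid : (⇑(Subgroup.subgroupOfEquivOfLe h) ∘ ⇑(Subgroup.subgroupOfEquivOfLe h).symm) = id := by
    funext x; simp
  rw [hid, Measure.map_id]

end Plumbing

/-! ## §2 The descent identity for `chartOrbG` -/

section Descent

variable (L : Type) [Field L] [NumberField L] [IsCMField L] (α : Fin 3 → L)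
  [MeasurableSpace ↥(arch (↥(maximalRealSubfield L)) L (IsCMField.complexConj L) 3 (Matrix.diagonal α))]
  [BorelSpace ↥(arch (↥(maximalRealSubfield L)) L (IsCMField.complexConj L) 3 (Matrix.diagonal α))]
  (ν' : Measure ↥(arch (↥(maximalRealSubfield L)) L (IsCMField.complexConj L) 3 (Matrix.diagonal α))) [ν'.IsHaarMeasure] [ν'.IsMulRightInvariant]
  (S' : Finset {w : InfinitePlace L // IsComplex w})

/-- **DESCENT OF `chartOrbG` TO THE CENTRALISER OF A CHART POINT — ONE DESCENDED TEST FUNCTION FOR THE WHOLE FAMILY.**  See the module docstring: given ONE compact `C″` with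
`y′·gprimeTorus c·y′⁻¹ ∈ tsupport a′ ⇒ y′ ∈ C″ · Z(gprimeTorus p)` for all `c ∈ K` (★ D4b-1 ∕ D4b-1β at a semi-regular `p`), there is ONE continuous compactly supported `(a′)_M` on
`M′ = Z(gprimeTorus p)` with `chartOrbG L α ν′ S′ a′ c = dt′(B′) · ∫_{M′ ⧸ T′} (a′)_M(k · gprimeTorus c · k⁻¹) d(νM ∕ νT′)` for every `c ∈ K` whose chart integrand is integrable
(`T′ = T_{S′} ∩ M′`, `νT′ = dt′` transported; ★ D3 `integral_descConj_eq_integral_descConj_descended` + ★ D2's cut-off).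
[cite: Rogawski1990, §4.12 Lemma 4.12.1 p. 66; §8.2 p. 114] [cite: HarishChandra1970, Part I §3 Lemmas 22–23] [cite: Folland1995, §2.6 Thm. 2.49] -/
theorem exists_descended_chartOrbG_eq
    (a' : ↥(arch (↥(maximalRealSubfield L)) L (IsCMField.complexConj L) 3 (Matrix.diagonal α)) → ℂ) (ha'c : Continuous a') (ha's : HasCompactSupport a')
    (p : {w : InfinitePlace L // IsComplex w} → Fin 3 → ℝ) {K : Set ({w : InfinitePlace L // IsComplex w} → Fin 3 → ℝ)}
    [MeasurableSpace (↥(Subgroup.centralizer ({gprimeTorus L α S' p} : Set ↥(arch (↥(maximalRealSubfield L)) L (IsCMField.complexConj L) 3 (Matrix.diagonal α)))) ⧸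
      (chartTorusG L α S').subgroupOf (Subgroup.centralizer ({gprimeTorus L α S' p} : Set ↥(arch (↥(maximalRealSubfield L)) L (IsCMField.complexConj L) 3 (Matrix.diagonal α)))))]
    [BorelSpace (↥(Subgroup.centralizer ({gprimeTorus L α S' p} : Set ↥(arch (↥(maximalRealSubfield L)) L (IsCMField.complexConj L) 3 (Matrix.diagonal α)))) ⧸
      (chartTorusG L α S').subgroupOf (Subgroup.centralizer ({gprimeTorus L α S' p} : Set ↥(arch (↥(maximalRealSubfield L)) L (IsCMField.complexConj L) 3 (Matrix.diagonal α)))))]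
    [LocallyCompactSpace ↥(Subgroup.centralizer ({gprimeTorus L α S' p} : Set ↥(arch (↥(maximalRealSubfield L)) L (IsCMField.complexConj L) 3 (Matrix.diagonal α))))]
    (νM : Measure ↥(Subgroup.centralizer ({gprimeTorus L α S' p} : Set ↥(arch (↥(maximalRealSubfield L)) L (IsCMField.complexConj L) 3 (Matrix.diagonal α)))))
    [νM.IsHaarMeasure] [νM.IsMulRightInvariant] [νM.IsInvInvariant]
    {C'' : Set ↥(arch (↥(maximalRealSubfield L)) L (IsCMField.complexConj L) 3 (Matrix.diagonal α))} (hC'' : IsCompact C'')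
    (hCM : ∀ c ∈ K, ∀ y' : ↥(arch (↥(maximalRealSubfield L)) L (IsCMField.complexConj L) 3 (Matrix.diagonal α)),
      y' * gprimeTorus L α S' c * y'⁻¹ ∈ tsupport a' →
        y' ∈ C'' * (Subgroup.centralizer ({gprimeTorus L α S' p} : Set ↥(arch (↥(maximalRealSubfield L)) L (IsCMField.complexConj L) 3 (Matrix.diagonal α))) :
          Set ↥(arch (↥(maximalRealSubfield L)) L (IsCMField.complexConj L) 3 (Matrix.diagonal α)))) :
    ∃ aM : ↥(Subgroup.centralizer ({gprimeTorus L α S' p} : Set ↥(arch (↥(maximalRealSubfield L)) L (IsCMField.complexConj L) 3 (Matrix.diagonal α)))) → ℂ,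
      Continuous aM ∧ HasCompactSupport aM ∧
        ∀ c, ∀ hc : c ∈ K,
          Integrable (descConj (gprimeTorus L α S' c) (chartTorusG L α S') (forall_mem_chartTorusG_comm L α S' c) a') (chartQuotientMeasureG L α ν' S') →
            chartOrbG L α ν' S' a' c =
              (haveI := isHaarMeasure_chartHaarG L α S'
               haveI := isInvInvariant_chartHaarG L α S'
               haveI := isHaarMeasure_map_subgroupOfEquivOfLe_symm (chartTorusG_le_centralizer L α S' p) (chartHaarG L α S')
               haveI := isInvInvariant_map_subgroupOfEquivOfLe_symm (chartTorusG_le_centralizer L α S' p) (chartHaarG L α S')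
              ((chartHaarG L α S' (chartBoxImgG L α S')).toReal : ℂ) *
                ∫ kq, descConj
                    (⟨gprimeTorus L α S' c, gprimeTorus_mem_centralizer L α S' p c⟩ :
                      ↥(Subgroup.centralizer ({gprimeTorus L α S' p} : Set ↥(arch (↥(maximalRealSubfield L)) L (IsCMField.complexConj L) 3 (Matrix.diagonal α)))))
                    ((chartTorusG L α S').subgroupOf (Subgroup.centralizer ({gprimeTorus L α S' p} : Set _)))
                    (fun s hs => Subtype.ext (forall_mem_chartTorusG_comm L α S' c (s : ↥(arch (↥(maximalRealSubfield L)) L (IsCMField.complexConj L) 3 (Matrix.diagonal α)))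
                      (Subgroup.mem_subgroupOf.1 hs)))
                    aM kq
                  ∂(quotientMeasure ((chartTorusG L α S').subgroupOf (Subgroup.centralizer ({gprimeTorus L α S' p} : Set _)))
                      (Measure.map (Subgroup.subgroupOfEquivOfLe (chartTorusG_le_centralizer L α S' p)).symm (chartHaarG L α S'))
                      (isClosed_subgroupOf_of_isClosed _ _ (isClosed_chartTorusG L α S')) νM)) := by
  have hM' : IsClosed ((Subgroup.centralizer ({gprimeTorus L α S' p} : Set ↥(arch (↥(maximalRealSubfield L)) L (IsCMField.complexConj L) 3 (Matrix.diagonal α)))) : Set ↥(arch (↥(maximalRealSubfield L)) L (IsCMField.complexConj L) 3 (Matrix.diagonal α))) :=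
    isClosed_centralizer_singleton_of_t2 _
  have hle : chartTorusG L α S' ≤ (Subgroup.centralizer ({gprimeTorus L α S' p} : Set ↥(arch (↥(maximalRealSubfield L)) L (IsCMField.complexConj L) 3 (Matrix.diagonal α)))) := chartTorusG_le_centralizer L α S' p
  -- ONE cut-off `β` of unit `M′`-mass on `C″ · M′`
  obtain ⟨β, hβc, hβs, hβ0, hβ1⟩ := exists_continuous_hasCompactSupport_integral_comp_mul_eq_one (Subgroup.centralizer ({gprimeTorus L α S' p} : Set ↥(arch (↥(maximalRealSubfield L)) L (IsCMField.complexConj L) 3 (Matrix.diagonal α)))) hM' νM hC''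
  refine ⟨fun m => ∫ x, β x • a' (x * (m : ↥(arch (↥(maximalRealSubfield L)) L (IsCMField.complexConj L) 3 (Matrix.diagonal α))) * x⁻¹) ∂ν',
    continuous_integral_conj_subtype ν' (Subgroup.centralizer ({gprimeTorus L α S' p} : Set ↥(arch (↥(maximalRealSubfield L)) L (IsCMField.complexConj L) 3 (Matrix.diagonal α)))) hβc hβs ha'c, hasCompactSupport_integral_conj ν' (Subgroup.centralizer ({gprimeTorus L α S' p} : Set ↥(arch (↥(maximalRealSubfield L)) L (IsCMField.complexConj L) 3 (Matrix.diagonal α)))) hM' hβs ha's, ?_⟩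
  intro c hc hint
  -- instances on the chart torus side
  letI : MeasurableSpace (↥(arch (↥(maximalRealSubfield L)) L (IsCMField.complexConj L) 3 (Matrix.diagonal α)) ⧸ chartTorusG L α S') := borel _
  haveI : BorelSpace (↥(arch (↥(maximalRealSubfield L)) L (IsCMField.complexConj L) 3 (Matrix.diagonal α)) ⧸ chartTorusG L α S') := ⟨rfl⟩
  haveI := isHaarMeasure_chartHaarG L α S'
  haveI := isInvInvariant_chartHaarG L α S'
  haveI : (chartHaarG L α S').IsMulRightInvariant := isMulRightInvariant_of_isInvInvariant _
  haveI := isHaarMeasure_map_subgroupOfEquivOfLe_symm hle (chartHaarG L α S')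
  haveI := isInvInvariant_map_subgroupOfEquivOfLe_symm hle (chartHaarG L α S')
  have key := integral_descConj_eq_integral_descConj_descended ν' (Subgroup.centralizer ({gprimeTorus L α S' p} : Set ↥(arch (↥(maximalRealSubfield L)) L (IsCMField.complexConj L) 3 (Matrix.diagonal α)))) hM' νM
    ⟨gprimeTorus L α S' c, gprimeTorus_mem_centralizer L α S' p c⟩
    (chartTorusG L α S') (isClosed_chartTorusG L α S') (forall_mem_chartTorusG_comm L α S' c)
    ((chartTorusG L α S').subgroupOf (Subgroup.centralizer ({gprimeTorus L α S' p} : Set ↥(arch (↥(maximalRealSubfield L)) L (IsCMField.complexConj L) 3 (Matrix.diagonal α))))) (isClosed_subgroupOf_of_isClosed _ _ (isClosed_chartTorusG L α S'))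
    (fun s hs => Subtype.ext (forall_mem_chartTorusG_comm L α S' c (s : ↥(arch (↥(maximalRealSubfield L)) L (IsCMField.complexConj L) 3 (Matrix.diagonal α)))
      (Subgroup.mem_subgroupOf.1 hs)))
    (fun s hs => Subgroup.mem_subgroupOf.1 hs)
    (chartHaarG L α S') (Measure.map (Subgroup.subgroupOfEquivOfLe hle).symm (chartHaarG L α S'))
    (eq_map_incl_map_subgroupOfEquivOfLe_symm hle (chartHaarG L α S'))
    hβc hβs hβ0 hβ1 ha'c ?_ (hCM c hc)
  · rw [chartOrbG_def]
    exact congrArg (fun z : ℂ => ((chartHaarG L α S' (chartBoxImgG L α S')).toReal : ℂ) * z) key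
  · -- the integrability hypothesis, in `quotientMeasure` spelling
    have hq : chartQuotientMeasureG L α ν' S' = quotientMeasure (chartTorusG L α S') (chartHaarG L α S') (isClosed_chartTorusG L α S') ν' := rfl
    rw [← hq]
    exact hint

/-! ### ED. 2 — the CUT-OFF-EXPLICIT, CENTRALISER-GENERIC form (cross-chart consistency: ONE `β`, hence ONE `(a′)_M`, for every chart whose torus lies in `Z(s)`)

Organ J reads the SAME wall point `s` through two charts (`S` near `p` and `insert w S` near `hcCayPt p`, ★ `gprimeTorus_of_wall`); both chart tori lie in `Z(s)`, so with
ONE cut-off `β` (unit `Z(s)`-mass on `(C″_S ∪ C″_{insert w S}) · Z(s)`, ★ `exists_continuous_hasCompactSupport_integral_comp_mul_eq_one`) the theorem below gives BOTH chart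
identities with the SAME descended function `m ↦ ∫ β(x) • a′(x m x⁻¹) dν′` (LH3-p02 (g2) 07:47:34Z hand-back (b): «one `a′_M` for both `S` near `p` and `insert w S` near `hcCayPt`»). -/

/-- **`chartOrbG` DESCENT WITH A GIVEN CUT-OFF, FOR ANY `s` CENTRALISING THE CHART TORUS** (pointwise in `c`): `T_{S′} ≤ Z(s)`, `νM` a right-∕inversion-invariant Haar measure on
`Z(s)`, `β ∈ C_c(G′_∞)`, `β ≥ 0`, of unit `Z(s)`-mass on `C″ · Z(s)`, and `c` a coordinate with `y′·gprimeTorus c·y′⁻¹ ∈ tsupport a′ ⇒ y′ ∈ C″ · Z(s)` whose chart integrand is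
integrable: then `chartOrbG L α ν′ S′ a′ c = dt′(B′) · ∫_{Z(s) ⧸ T′} (a′)_M^β(k · gprimeTorus c · k⁻¹) d(νM ∕ νT′)`, `(a′)_M^β(m) = ∫ β(x) • a′(x m x⁻¹) dν′`, `T′ = T_{S′} ∩ Z(s)`.
Use with the SAME `β` for several charts ⇒ the same `(a′)_M^β`. [cite: Rogawski1990, §4.12 Lemma 4.12.1 p. 66; §8.2 p. 114] [cite: HarishChandra1970, Part I §3 Lemmas 22–23]
[cite: Folland1995, §2.6 Thm. 2.49] -/
theorem chartOrbG_eq_integral_descended_of_cutoff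
    (a' : ↥(arch (↥(maximalRealSubfield L)) L (IsCMField.complexConj L) 3 (Matrix.diagonal α)) → ℂ) (ha'c : Continuous a') (s : ↥(arch (↥(maximalRealSubfield L)) L (IsCMField.complexConj L) 3 (Matrix.diagonal α)))
    [MeasurableSpace (↥(Subgroup.centralizer ({s} : Set ↥(arch (↥(maximalRealSubfield L)) L (IsCMField.complexConj L) 3 (Matrix.diagonal α)))) ⧸ (chartTorusG L α S').subgroupOf (Subgroup.centralizer ({s} : Set ↥(arch (↥(maximalRealSubfield L)) L (IsCMField.complexConj L) 3 (Matrix.diagonal α)))))] [BorelSpace (↥(Subgroup.centralizer ({s} : Set ↥(arch (↥(maximalRealSubfield L)) L (IsCMField.complexConj L) 3 (Matrix.diagonal α)))) ⧸ (chartTorusG L α S').subgroupOf (Subgroup.centralizer ({s} : Set ↥(arch (↥(maximalRealSubfield L)) L (IsCMField.complexConj L) 3 (Matrix.diagonal α)))))]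
    [LocallyCompactSpace ↥(Subgroup.centralizer ({s} : Set ↥(arch (↥(maximalRealSubfield L)) L (IsCMField.complexConj L) 3 (Matrix.diagonal α))))]
    (νM : Measure ↥(Subgroup.centralizer ({s} : Set ↥(arch (↥(maximalRealSubfield L)) L (IsCMField.complexConj L) 3 (Matrix.diagonal α))))) [νM.IsHaarMeasure] [νM.IsMulRightInvariant] [νM.IsInvInvariant]
    (hT : chartTorusG L α S' ≤ (Subgroup.centralizer ({s} : Set ↥(arch (↥(maximalRealSubfield L)) L (IsCMField.complexConj L) 3 (Matrix.diagonal α)))))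
    {C'' : Set ↥(arch (↥(maximalRealSubfield L)) L (IsCMField.complexConj L) 3 (Matrix.diagonal α))} {β : ↥(arch (↥(maximalRealSubfield L)) L (IsCMField.complexConj L) 3 (Matrix.diagonal α)) → ℝ} (hβc : Continuous β) (hβs : HasCompactSupport β) (hβ0 : ∀ g, 0 ≤ β g)
    (hβ1 : ∀ x ∈ C'', ∀ k₀ : ↥(Subgroup.centralizer ({s} : Set ↥(arch (↥(maximalRealSubfield L)) L (IsCMField.complexConj L) 3 (Matrix.diagonal α)))), ∫ h : ↥(Subgroup.centralizer ({s} : Set ↥(arch (↥(maximalRealSubfield L)) L (IsCMField.complexConj L) 3 (Matrix.diagonal α)))), β (x * (k₀ : ↥(arch (↥(maximalRealSubfield L)) L (IsCMField.complexConj L) 3 (Matrix.diagonal α))) * (h : ↥(arch (↥(maximalRealSubfield L)) L (IsCMField.complexConj L) 3 (Matrix.diagonal α)))) ∂νM = 1)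
    (c : {w : InfinitePlace L // IsComplex w} → Fin 3 → ℝ)
    (hint : Integrable (descConj (gprimeTorus L α S' c) (chartTorusG L α S') (forall_mem_chartTorusG_comm L α S' c) a') (chartQuotientMeasureG L α ν' S'))
    (hCM : ∀ y' : ↥(arch (↥(maximalRealSubfield L)) L (IsCMField.complexConj L) 3 (Matrix.diagonal α)), y' * gprimeTorus L α S' c * y'⁻¹ ∈ tsupport a' → y' ∈ C'' * ((Subgroup.centralizer ({s} : Set ↥(arch (↥(maximalRealSubfield L)) L (IsCMField.complexConj L) 3 (Matrix.diagonal α)))) : Set ↥(arch (↥(maximalRealSubfield L)) L (IsCMField.complexConj L) 3 (Matrix.diagonal α)))) :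
    chartOrbG L α ν' S' a' c =
      (haveI := isHaarMeasure_chartHaarG L α S'
       haveI := isInvInvariant_chartHaarG L α S'
       haveI := isHaarMeasure_map_subgroupOfEquivOfLe_symm hT (chartHaarG L α S')
       haveI := isInvInvariant_map_subgroupOfEquivOfLe_symm hT (chartHaarG L α S')
      ((chartHaarG L α S' (chartBoxImgG L α S')).toReal : ℂ) *
        ∫ kq, descConj (⟨gprimeTorus L α S' c, hT (gprimeTorus_mem_chartTorusG L α S' c)⟩ : ↥(Subgroup.centralizer ({s} : Set ↥(arch (↥(maximalRealSubfield L)) L (IsCMField.complexConj L) 3 (Matrix.diagonal α)))))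
            ((chartTorusG L α S').subgroupOf (Subgroup.centralizer ({s} : Set ↥(arch (↥(maximalRealSubfield L)) L (IsCMField.complexConj L) 3 (Matrix.diagonal α)))))
            (fun t ht => Subtype.ext (forall_mem_chartTorusG_comm L α S' c (t : ↥(arch (↥(maximalRealSubfield L)) L (IsCMField.complexConj L) 3 (Matrix.diagonal α))) (Subgroup.mem_subgroupOf.1 ht)))
            (fun m : ↥(Subgroup.centralizer ({s} : Set ↥(arch (↥(maximalRealSubfield L)) L (IsCMField.complexConj L) 3 (Matrix.diagonal α)))) => ∫ x, β x • a' (x * (m : ↥(arch (↥(maximalRealSubfield L)) L (IsCMField.complexConj L) 3 (Matrix.diagonal α))) * x⁻¹) ∂ν') kq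
          ∂(quotientMeasure ((chartTorusG L α S').subgroupOf (Subgroup.centralizer ({s} : Set ↥(arch (↥(maximalRealSubfield L)) L (IsCMField.complexConj L) 3 (Matrix.diagonal α)))))
              (Measure.map (Subgroup.subgroupOfEquivOfLe hT).symm (chartHaarG L α S'))
              (isClosed_subgroupOf_of_isClosed _ _ (isClosed_chartTorusG L α S')) νM)) := by
  have hM' : IsClosed ((Subgroup.centralizer ({s} : Set ↥(arch (↥(maximalRealSubfield L)) L (IsCMField.complexConj L) 3 (Matrix.diagonal α)))) : Set ↥(arch (↥(maximalRealSubfield L)) L (IsCMField.complexConj L) 3 (Matrix.diagonal α))) := isClosed_centralizer_singleton_of_t2 _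
  letI : MeasurableSpace (↥(arch (↥(maximalRealSubfield L)) L (IsCMField.complexConj L) 3 (Matrix.diagonal α)) ⧸ chartTorusG L α S') := borel _
  haveI : BorelSpace (↥(arch (↥(maximalRealSubfield L)) L (IsCMField.complexConj L) 3 (Matrix.diagonal α)) ⧸ chartTorusG L α S') := ⟨rfl⟩
  haveI := isHaarMeasure_chartHaarG L α S'
  haveI := isInvInvariant_chartHaarG L α S'
  haveI : (chartHaarG L α S').IsMulRightInvariant := isMulRightInvariant_of_isInvInvariant _
  haveI := isHaarMeasure_map_subgroupOfEquivOfLe_symm hT (chartHaarG L α S')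
  haveI := isInvInvariant_map_subgroupOfEquivOfLe_symm hT (chartHaarG L α S')
  have key := integral_descConj_eq_integral_descConj_descended ν' (Subgroup.centralizer ({s} : Set ↥(arch (↥(maximalRealSubfield L)) L (IsCMField.complexConj L) 3 (Matrix.diagonal α)))) hM' νM
    ⟨gprimeTorus L α S' c, hT (gprimeTorus_mem_chartTorusG L α S' c)⟩
    (chartTorusG L α S') (isClosed_chartTorusG L α S') (forall_mem_chartTorusG_comm L α S' c)
    ((chartTorusG L α S').subgroupOf (Subgroup.centralizer ({s} : Set ↥(arch (↥(maximalRealSubfield L)) L (IsCMField.complexConj L) 3 (Matrix.diagonal α))))) (isClosed_subgroupOf_of_isClosed _ _ (isClosed_chartTorusG L α S'))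
    (fun t ht => Subtype.ext (forall_mem_chartTorusG_comm L α S' c (t : ↥(arch (↥(maximalRealSubfield L)) L (IsCMField.complexConj L) 3 (Matrix.diagonal α))) (Subgroup.mem_subgroupOf.1 ht)))
    (fun t ht => Subgroup.mem_subgroupOf.1 ht)
    (chartHaarG L α S') (Measure.map (Subgroup.subgroupOfEquivOfLe hT).symm (chartHaarG L α S'))
    (eq_map_incl_map_subgroupOfEquivOfLe_symm hT (chartHaarG L α S'))
    hβc hβs hβ0 hβ1 ha'c ?_ hCM
  · rw [chartOrbG_def]
    exact congrArg (fun z : ℂ => ((chartHaarG L α S' (chartBoxImgG L α S')).toReal : ℂ) * z) key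
  · have hq : chartQuotientMeasureG L α ν' S' = quotientMeasure (chartTorusG L α S') (chartHaarG L α S') (isClosed_chartTorusG L α S') ν' := rfl
    rw [← hq]
    exact hint

end Descent

end Literature.NumberTheory.Rogawski1990
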